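import Summits.CriticalPhenomena.PercolationContinuityZ3.Theorems.Transplant.Slab111HubTab3
import Summits.CriticalPhenomena.PercolationContinuityZ3.Theorems.Transplant.Slab111HubZone
import HarnessLib

/-!
# The HUB ROUTING of the `(111)`-films, XVIII: the pattern of a level configuration and the hypotheses of `Entry.swap2` it yields

builds on p205010 (kernel theorem, internal audit signed; external expert review pending) — NOT used in this file.  Lane `prim-bschramm`, seat
`prim-bschramm-p2` (gen 36; class C1b; memo `HOME/bschramm/P2-LATTICES.md` §130); helper file (`--supports stmt-CriticalPhenomena-4575 --as helper`).
With the hub zone at `Hlo` («Slab111HubZone».`zone_exists`, `Λ = 3`) a terminal at level `n` has side `d = dirOfLevel 3 Hlo n`, boundary flag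
`βOf k d n` (clamped distance to the boundary behind it, §1) and each pair the clamped difference `clampτ (nJ − nI)`.  §1 proves the
realisability rules of «Slab111HubTab3» for these values (`pairRuleB_of_levels`, `maybeB_of_levels`, flag range); §2 turns the PAIR VALIDITY
`pairOKB` of an entry at the realised `τ` into the four hypotheses of «Slab111HubEntry2».`Entry.swap2` for that pair (`pair_hyps`: the bit's
`LegAvoids`, the two separations, the vertex-distinctness), the opposite-side pairs being separated by the zone (`pair_hyps_opp`).
[cite: DuminilCopinSidoraviciusTassion2016, §2.3 (proof of Fact 2: the three disjoint paths γ_u, γ_v, γ_w in B_R(z))]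
-/

noncomputable section

namespace Summit.CriticalPhenomena.PercolationContinuityZ3.Theorems.Transplant

open scoped Classical

namespace Slab111

/-! ## §1 Flags, clamped differences and the realisability rules -/

/-- **The boundary flag** of a terminal at level `n` on side `d`: its distance to the boundary behind it (`n` below the zone, `k − n` above),
clamped to `{0, 1, 2}`. [folklore] -/
def βOf (k : ℕ) (d n : ℤ) : ℕ := (min 2 (if d = 1 then n else (k : ℤ) - n)).toNat

/-- The flag is `< 3`. [folklore] -/
theorem βOf_lt (k : ℕ) (d n : ℤ) : βOf k d n < 3 := by
  unfold βOf; have := min_le_left (2 : ℤ) (if d = 1 then n else (k : ℤ) - n); omega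

/-- Semantics of the flag (`0 ≤ n ≤ k`): with `dist = n` (`d = 1`) or `k − n`: flag `0 ⇔ dist = 0`, `1 ⇔ dist = 1`, `2 ⇔ dist ≥ 2`. [folklore] -/
theorem βOf_spec {k : ℕ} {d n : ℤ} (hd : d = 1 ∨ d = -1) (h0 : 0 ≤ n) (hk : n ≤ k) :
    0 ≤ (if d = 1 then n else (k : ℤ) - n) ∧ (βOf k d n = 0 ↔ (if d = 1 then n else (k : ℤ) - n) = 0) ∧
      (βOf k d n = 1 ↔ (if d = 1 then n else (k : ℤ) - n) = 1) ∧ (βOf k d n = 2 ↔ 2 ≤ (if d = 1 then n else (k : ℤ) - n)) := by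
  unfold βOf
  rcases hd with rfl | rfl
  · simp only [↓reduceIte]; refine ⟨h0, ?_, ?_, ?_⟩ <;> omega
  · simp only [show ¬ ((-1 : ℤ) = 1) by norm_num, ↓reduceIte]; refine ⟨by omega, ?_, ?_, ?_⟩ <;> omega

/-- The three cases of the flag. [folklore] -/
theorem βOf_cases {k : ℕ} {d n : ℤ} (hd : d = 1 ∨ d = -1) (h0 : 0 ≤ n) (hk : n ≤ k) :
    ((if d = 1 then n else (k : ℤ) - n) = 0 ∧ βOf k d n = 0) ∨ ((if d = 1 then n else (k : ℤ) - n) = 1 ∧ βOf k d n = 1) ∨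
      (2 ≤ (if d = 1 then n else (k : ℤ) - n) ∧ βOf k d n = 2) := by
  obtain ⟨h, b0, b1, b2⟩ := βOf_spec (k := k) hd h0 hk
  have hb := βOf_lt k d n
  interval_cases hβ : βOf k d n
  · left; exact ⟨b0.1 rfl, rfl⟩
  · right; left; exact ⟨b1.1 rfl, rfl⟩
  · right; right; exact ⟨b2.1 rfl, rfl⟩

/-- A clamped value is one of `TAUS`. [folklore] -/
theorem clampτ_mem_TAUS (x : ℤ) : clampτ x ∈ TAUS := by
  have h1 : -7 ≤ clampτ x := le_max_left _ _
  have h2 : clampτ x ≤ 7 := max_le (by norm_num) (min_le_left _ _)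
  generalize clampτ x = t at h1 h2
  simp only [TAUS, List.mem_cons, List.not_mem_nil, or_false]
  omega

/-- `0 ∈ TAUS`. [folklore] -/
theorem zero_mem_TAUS : (0 : ℤ) ∈ TAUS := by decide

/-- The three cases of `clampτ`. [folklore] -/
theorem clampτ_cases (x : ℤ) : (7 ≤ x ∧ clampτ x = 7) ∨ (x ≤ -7 ∧ clampτ x = -7) ∨ (-6 ≤ x ∧ x ≤ 6 ∧ clampτ x = x) := by
  unfold clampτ
  by_cases h7 : 7 ≤ x
  · left; rw [min_eq_left h7, max_eq_right (by norm_num)]; exact ⟨h7, rfl⟩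
  · rw [min_eq_right (by omega)]
    by_cases hm : x ≤ -7
    · right; left; rw [max_eq_left hm]; exact ⟨hm, rfl⟩
    · right; right; rw [max_eq_right (by omega)]; exact ⟨by omega, by omega, rfl⟩

/-- Semantics of `clampτ`. [folklore] -/
theorem clampτ_spec (x : ℤ) : (clampτ x = 7 ↔ 7 ≤ x) ∧ (clampτ x = -7 ↔ x ≤ -7) ∧ (-6 ≤ x → x ≤ 6 → clampτ x = x) ∧
    -7 ≤ clampτ x ∧ clampτ x ≤ 7 ∧ (-6 ≤ clampτ x → clampτ x ≤ 6 → clampτ x = x) := by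
  rcases clampτ_cases x with ⟨h, e⟩ | ⟨h, e⟩ | ⟨h, h', e⟩ <;> rw [e] <;>
    refine ⟨⟨fun h => ?_, fun h => ?_⟩, ⟨fun h => ?_, fun h => ?_⟩, fun h1 h2 => ?_, ?_, ?_, fun h1 h2 => ?_⟩ <;> omega

/-- **The pair rule holds for the realised flags and difference** (same side `d`, levels in `[0, k]`, distinct terminals). [folklore] -/
theorem pairRuleB_of_levels {k : ℕ} {d nI nJ : ℤ} (hd : d = 1 ∨ d = -1) (hI : 0 ≤ nI ∧ nI ≤ k) (hJ : 0 ≤ nJ ∧ nJ ≤ k) {qI qJ : ℤ × ℤ}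
    (hne : (qI, nI) ≠ (qJ, nJ)) : pairRuleB (βOf k d nI) (βOf k d nJ) (clampτ (nJ - nI)) d (qI == qJ) = true := by
  have cI := βOf_cases (k := k) hd hI.1 hI.2
  have cJ := βOf_cases (k := k) hd hJ.1 hJ.2
  have cτ := clampτ_cases (nJ - nI)
  unfold pairRuleB
  rw [Bool.and_eq_true]
  constructor
  · -- same column ⇒ different levels ⇒ τ ≠ 0
    rw [Bool.not_eq_true', Bool.and_eq_false_iff]
    by_cases hq : qI = qJ
    · right
      have hn : nI ≠ nJ := fun e => hne (by rw [hq, e])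
      rw [beq_eq_false_iff_ne]
      rcases cτ with ⟨h, e⟩ | ⟨h, e⟩ | ⟨h, h', e⟩ <;> rw [e] <;> omega
    · left; rw [beq_eq_false_iff_ne]; exact hq
  · rw [decide_eq_true_eq, max_le_iff, le_min_iff, le_min_iff]
    rcases hd with rfl | rfl
    · simp only [↓reduceIte] at cI cJ ⊢
      rcases cI with ⟨hi, ei⟩ | ⟨hi, ei⟩ | ⟨hi, ei⟩ <;> rcases cJ with ⟨hj, ej⟩ | ⟨hj, ej⟩ | ⟨hj, ej⟩ <;>
        rcases cτ with ⟨h, e⟩ | ⟨h, e⟩ | ⟨h, h', e⟩ <;> rw [ei, ej, e] <;> simp only [AloB, AhiB, uncLo, uncHi] <;> split_ifs <;> first | contradiction | omega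
    · simp only [show ¬ ((-1 : ℤ) = 1) by norm_num, ↓reduceIte] at cI cJ ⊢
      rcases cI with ⟨hi, ei⟩ | ⟨hi, ei⟩ | ⟨hi, ei⟩ <;> rcases cJ with ⟨hj, ej⟩ | ⟨hj, ej⟩ | ⟨hj, ej⟩ <;>
        rcases cτ with ⟨h, e⟩ | ⟨h, e⟩ | ⟨h, h', e⟩ <;> rw [ei, ej, e] <;> simp only [AloB, AhiB, uncLo, uncHi] <;> split_ifs <;> first | contradiction | omega

/-- Lower half of the triangle rule. [folklore] -/
theorem maybe_low {a c x y : ℤ} (ha : (7 ≤ x ∧ a = 7) ∨ (x ≤ -7 ∧ a = -7) ∨ (-6 ≤ x ∧ x ≤ 6 ∧ a = x))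
    (hc : (7 ≤ y ∧ c = 7) ∨ (y ≤ -7 ∧ c = -7) ∨ (-6 ≤ y ∧ y ≤ 6 ∧ c = y))
    {b : ℤ} (hb : (7 ≤ x + y ∧ b = 7) ∨ (x + y ≤ -7 ∧ b = -7) ∨ (-6 ≤ x + y ∧ x + y ≤ 6 ∧ b = x + y)) :
    clampτ (uncLo a + uncLo c) ≤ b := by
  unfold uncLo clampτ
  rw [max_def, min_def]
  split_ifs <;> omega

/-- Upper half of the triangle rule. [folklore] -/
theorem maybe_high {a c x y : ℤ} (ha : (7 ≤ x ∧ a = 7) ∨ (x ≤ -7 ∧ a = -7) ∨ (-6 ≤ x ∧ x ≤ 6 ∧ a = x))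
    (hc : (7 ≤ y ∧ c = 7) ∨ (y ≤ -7 ∧ c = -7) ∨ (-6 ≤ y ∧ y ≤ 6 ∧ c = y))
    {b : ℤ} (hb : (7 ≤ x + y ∧ b = 7) ∨ (x + y ≤ -7 ∧ b = -7) ∨ (-6 ≤ x + y ∧ x + y ≤ 6 ∧ b = x + y)) :
    b ≤ clampτ (uncHi a + uncHi c) := by
  unfold uncHi clampτ
  rw [max_def, min_def]
  split_ifs <;> omega

/-- **The triangle rule holds for realised differences.** [folklore] -/
theorem maybeB_of_levels (n₁ n₂ n₃ : ℤ) : maybeB (clampτ (n₂ - n₁)) (clampτ (n₃ - n₁)) (clampτ (n₃ - n₂)) = true := by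
  have h3 : n₃ - n₁ = (n₂ - n₁) + (n₃ - n₂) := by ring
  rw [h3]
  have ha := clampτ_cases (n₂ - n₁); have hc := clampτ_cases (n₃ - n₂); have hb := clampτ_cases ((n₂ - n₁) + (n₃ - n₂))
  unfold maybeB
  rw [Bool.and_eq_true, decide_eq_true_eq, decide_eq_true_eq]
  exact ⟨maybe_low ha hc hb, maybe_high ha hc hb⟩

/-! ## §2 From pair validity to the hypotheses of `Entry.swap2` -/

/-- **The exclusion bit of the ordered pair `(I, J)`** ("`I`'s leg avoids `J`'s face"): same side, level-far, and `I` nearer the zone. [folklore] -/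
def xbOf (Hlo nI nJ : ℤ) : Bool :=
  decide (dirOfLevel 3 Hlo nI = dirOfLevel 3 Hlo nJ ∧ (clampτ (nJ - nI) = 7 ∨ clampτ (nJ - nI) = -7) ∧
    ¬ ((dirOfLevel 3 Hlo nI = 1 ∧ clampτ (nJ - nI) = 7) ∨ (dirOfLevel 3 Hlo nI = -1 ∧ clampτ (nJ - nI) = -7)))

/-- `clampτ (nI − nJ) = −clampτ (nJ − nI)`. [folklore] -/
theorem clampτ_neg (nI nJ : ℤ) : clampτ (nI - nJ) = -clampτ (nJ - nI) := by
  unfold clampτ; rw [max_def, max_def, min_def, min_def]; split_ifs <;> omega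

/-- **THE HYPOTHESES OF `Entry.swap2` FOR A SAME-SIDE PAIR** from the pair validity at the realised `τ` (`Λ = 3`; both terminals clear the
zone): the bits' `LegAvoids`, the two separations (bit / window / local), and far-or-distinct. [folklore] -/
theorem pair_hyps {Hlo nI nJ : ℤ} (hcI : Clears 3 Hlo nI) (hcJ : Clears 3 Hlo nJ) {lI lJ : List MV} {qI qJ : ℤ × ℤ} {FI FJ : FaceD}
    (hd : dirOfLevel 3 Hlo nI = dirOfLevel 3 Hlo nJ)
    (hv : pairOKB lI lJ qI qJ FI FJ (dirOfLevel 3 Hlo nI) (clampτ (nJ - nI)) = true) :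
    (xbOf Hlo nI nJ = true → LegAvoids lI qI FJ) ∧ (xbOf Hlo nJ nI = true → LegAvoids lJ qJ FI) ∧
    (xbOf Hlo nI nJ = true ∨ nI + 3 < min (nJ - 3) (Hlo - 1) ∨ max (nJ + 3) (Hlo + 3 + 1) < nI - 3 ∨
      LocSep lI lJ qI FJ (dirOfLevel 3 Hlo nI) nI nJ) ∧
    (xbOf Hlo nJ nI = true ∨ nJ + 3 < min (nI - 3) (Hlo - 1) ∨ max (nI + 3) (Hlo + 3 + 1) < nJ - 3 ∨
      LocSep lJ lI qJ FI (dirOfLevel 3 Hlo nJ) nJ nI) ∧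
    ((nI + 2 * 3 < nJ ∨ nJ + 2 * 3 < nI) ∨ ∀ p ∈ lI, ∀ p' ∈ lJ, (qI + p.1, nI + p.2) ≠ (qJ + p'.1, nJ + p'.2)) := by
  obtain ⟨c7, cm7, cid, clo, chi, cid'⟩ := clampτ_spec (nJ - nI)
  have hdI := dirOfLevel_eq 3 Hlo nI
  have mI := dir_margin hcI; have mJ := dir_margin hcJ
  rw [← hd] at mJ
  by_cases hfar : clampτ (nJ - nI) = 7 ∨ clampτ (nJ - nI) = -7
  · -- FAR
    have hfar' : nI + 2 * 3 < nJ ∨ nJ + 2 * 3 < nI := by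
      rcases hfar with h | h
      · have := c7.1 h; omega
      · have := cm7.1 h; omega
    by_cases hJn : (dirOfLevel 3 Hlo nI = 1 ∧ clampτ (nJ - nI) = 7) ∨ (dirOfLevel 3 Hlo nI = -1 ∧ clampτ (nJ - nI) = -7)
    · -- J nearer: J's bit is on, I is separated by window
      have aJ : LegAvoids lJ qJ FI := pairOKB_farJ hv hfar hJn
      have xJ : xbOf Hlo nJ nI = true := by
        unfold xbOf; rw [decide_eq_true_eq, clampτ_neg nI nJ]; refine ⟨hd.symm, by omega, ?_⟩
        rw [← hd]; rintro (⟨e, h⟩ | ⟨e, h⟩) <;> rcases hJn with ⟨e', h'⟩ | ⟨e', h'⟩ <;> omega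
      refine ⟨fun hx => ?_, fun _ => aJ, ?_, Or.inl xJ, Or.inl hfar'⟩
      · exfalso; unfold xbOf at hx; rw [decide_eq_true_eq] at hx; exact hx.2.2 hJn
      · right
        rcases hJn with ⟨e, h⟩ | ⟨e, h⟩
        · left; have := mI.1 e; have := c7.1 h; rw [lt_min_iff]; constructor <;> omega
        · right; left; have := mI.2 e; have := cm7.1 h; rw [max_lt_iff]; constructor <;> omega
    · -- I nearer
      have aI : LegAvoids lI qI FJ := pairOKB_farI hv hfar hJn
      have xI : xbOf Hlo nI nJ = true := by unfold xbOf; rw [decide_eq_true_eq]; exact ⟨hd, hfar, hJn⟩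
      refine ⟨fun _ => aI, fun hx => ?_, Or.inl xI, ?_, Or.inl hfar'⟩
      · exfalso; unfold xbOf at hx; rw [decide_eq_true_eq, clampτ_neg nI nJ, ← hd] at hx
        obtain ⟨-, h2, h3⟩ := hx
        apply hJn
        rcases hdI with e | e
        · rcases hfar with h | h
          · exact Or.inl ⟨e, h⟩
          · exfalso; exact h3 (Or.inl ⟨e, by omega⟩)
        · rcases hfar with h | h
          · exfalso; exact h3 (Or.inr ⟨e, by omega⟩)
          · exact Or.inr ⟨e, h⟩
      · right
        rcases hdI with e | e
        · have hτ : clampτ (nJ - nI) = -7 := by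
            rcases hfar with h | h
            · exact absurd (Or.inl ⟨e, h⟩) hJn
            · exact h
          left; have := mJ.1 e; have := cm7.1 hτ; rw [lt_min_iff]; constructor <;> omega
        · have hτ : clampτ (nJ - nI) = 7 := by
            rcases hfar with h | h
            · exact h
            · exact absurd (Or.inr ⟨e, h⟩) hJn
          right; left; have := mJ.2 e; have := c7.1 hτ; rw [max_lt_iff]; constructor <;> omega
  · -- TIGHT: `nJ = nI + τ`
    have hτ : nJ = nI + clampτ (nJ - nI) := by
      have h1 : -6 ≤ clampτ (nJ - nI) := by omega
      have h2 : clampτ (nJ - nI) ≤ 6 := by omega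
      have := cid' h1 h2; omega
    obtain ⟨locI, locJ, dv⟩ := pairOKB_tight hv hfar hτ
    have xI : xbOf Hlo nI nJ = false := by
      rw [Bool.eq_false_iff]; intro hx; unfold xbOf at hx; rw [decide_eq_true_eq] at hx; exact hfar hx.2.1
    have xJ : xbOf Hlo nJ nI = false := by
      rw [Bool.eq_false_iff]; intro hx; unfold xbOf at hx; rw [decide_eq_true_eq, clampτ_neg nI nJ] at hx; omega
    refine ⟨fun hx => ?_, fun hx => ?_, Or.inr (Or.inr (Or.inr locI)), Or.inr (Or.inr (Or.inr (hd ▸ locJ))), Or.inr dv⟩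
    · rw [xI] at hx; exact absurd hx (by simp)
    · rw [xJ] at hx; exact absurd hx (by simp)

/-- **Opposite-side pairs are separated by the zone**: bits off, window separation, far. [folklore] -/
theorem pair_hyps_opp {Hlo nI nJ : ℤ} (hcI : Clears 3 Hlo nI) (hcJ : Clears 3 Hlo nJ) (hd : dirOfLevel 3 Hlo nI ≠ dirOfLevel 3 Hlo nJ) :
    xbOf Hlo nI nJ = false ∧
    (nI + 3 < min (nJ - 3) (Hlo - 1) ∨ max (nJ + 3) (Hlo + 3 + 1) < nI - 3) ∧ (nI + 2 * 3 < nJ ∨ nJ + 2 * 3 < nI) := by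
  have mI := dir_margin hcI; have mJ := dir_margin hcJ
  refine ⟨by rw [Bool.eq_false_iff]; intro hx; unfold xbOf at hx; rw [decide_eq_true_eq] at hx; exact hd hx.1, ?_, ?_⟩
  · rcases dirOfLevel_eq 3 Hlo nI with e | e <;> rcases dirOfLevel_eq 3 Hlo nJ with e' | e'
    · exact absurd (e.trans e'.symm) hd
    · left; have := mI.1 e; have := mJ.2 e'; rw [lt_min_iff]; constructor <;> omega
    · right; have := mI.2 e; have := mJ.1 e'; rw [max_lt_iff]; constructor <;> omega
    · exact absurd (e.trans e'.symm) hd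
  · rcases dirOfLevel_eq 3 Hlo nI with e | e <;> rcases dirOfLevel_eq 3 Hlo nJ with e' | e'
    · exact absurd (e.trans e'.symm) hd
    · have := mI.1 e; have := mJ.2 e'; omega
    · have := mI.2 e; have := mJ.1 e'; omega
    · exact absurd (e.trans e'.symm) hd

end Slab111

end Summit.CriticalPhenomena.PercolationContinuityZ3.Theorems.Transplant

end
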